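import Summits.Ventures.HSemireg.WedgeHankelDivisorIntersection

/-!
# Venture HSemireg — NODE IMAGES AND NODE KERNELS IN GENERAL POSITION IN EVERY DEGREE: for ANY divisor of total order `D ≤ k + 1` (distinct nodes, `k + P_i ≤ n`) the node images
# are INDEPENDENT on `⋀^{k′}` and `dim ⋂_i (SI_k ⊔ Φs λ_i xRich(k, P_i)) = C(2n, k) − D·C(n, k)`; hence DIVISOR TORELLI in every degree — F2b/F2d/D9 without `D ≤ n + 1 − k`

HONEST FRAMING. Part of the Lean index of the computation cell `pub-hsemireg` (seat p10 gen 17, Sunday typer «UNIFORM-IN-n»).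
Finite-dimensional EXTERIOR ALGEBRA over a field ONLY: no variety, no cohomology theory, no sheaf, no Ext group, no semiregularity map;
nothing here says that HC / HC_CM / HC_AV holds; no Literature fact is declared or used.  Custodian versions as in `WedgeHankelSiegelIdeal` (1/3) and
`WedgeKernelDuality`; the dictionary (node classes `exp(λΘ)·p(Θ)` ↦ `w_n(expMul λ q)`; the DIVISOR `Σ_i (P_i+1)[λ_i]`) is QUOTED, never asserted.

WHAT IS IN THE TREE.  F2b `finrank_Kr_w_expMul_sum_add` / F2d `iSupIndep_V_w_expMul` (node kernels in general position / node images independent for `D ≤ k + 1` AND `D ≤ n + 1 − k`,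
from the divisor RANK law); D9 (Torelli for secant node sets, same range); G4 `iSupIndep_V_w_expMul''` (this seat: independence in the ONE degree `k′ = n + 1 − D`, by module-valued
Hermite interpolation).  THIS FILE moves G4's independence DOWN to every degree `k′ ≤ n + 1 − D` by multiplying with monomials, and reads the divisor back off the intersection
(namespace `Summit.Ventures.HSemireg.Wedge.KernelDuality` continued; imports G4):
* §105 GENERIC: **`finrank_iSup_eq_sum_of_iSupIndep`** (an independent finite family of subspaces has `dim ⨆ = Σ dim`; induction with `finrank_sup_add_finrank_inf_eq`).
* §106 `Hom_mul_V_le` (`Hom(univ, e) ∧ V(univ, f, a) ≤ V(univ, f, e + a)`); **`eq_zero_of_forall_B_mul_left_eq_zero`**: a homogeneous `x` of degree `d` with `E_U ∧ x = 0` for every `|U| = e`,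
  `e + d ≤ 2n`, is zero (E1's non-degeneracy, monomials split).
* §107 **`iSupIndep_V_w_expMul_of_total_le`: the node images `V(univ, w_n(expMul λ_i q_i), k′)` of a divisor with distinct nodes, exact orders `P_i ≤ k′` and total order
  `D ≤ k + 1` (`k + k′ = n`) are INDEPENDENT** (if `x` lies in one image and in the sum of the others, so does `E_U ∧ x` in degree `k′ + (k + 1 − D) = n + 1 − D`, where G4 applies;
  then §106); **`finrank_iSup_V_w_expMul_eq`** (`dim ⨆ = D·C(n,k)`) and the dual COUNT **`finrank_iInf_Kr_w_expMul_add`: `dim ⋂_i Kr(univ, w_n(expMul λ_i q_i), k) + D·C(n,k) =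
  C(2n,k)`** — F2b's count for the intersection with NO `D ≤ n + 1 − k` (the class kernel equals the intersection only in F2b's range).
* §108 DIVISOR TORELLI IN EVERY DEGREE (`D ≤ k`): **`iInf_Kr_w_expMul_not_le_Kr_w_exp`** (the node kernels of a divisor of total order `≤ k` do not jointly lie in the frame ideal of
  a further slope), **`iInf_Kr_w_expMul_not_le_succ`** (nor in the kernel of a higher-order class at one of its own nodes), hence **`range_eq_of_iInf_Kr_w_expMul_eq`** and
  **`order_eq_of_iInf_Kr_w_expMul_eq`**: two divisors of total order `≤ k` with the same intersection of node kernels in degree `k` have the same nodes AND the same orders.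
NOT typed here: a node at `∞` in §107/§108 (swap); the intersection for `D ≥ k + 1` is `SI_k` (G4) and determines nothing; anything Ext-side.  Class side only; new names only.
-/

open Module

namespace Summit.Ventures.HSemireg.Wedge.KernelDuality

open Summit.Ventures.HSemireg.Wedge Summit.Ventures.HSemireg.Wedge.Kunneth Summit.Ventures.HSemireg.Wedge.Hankel
  Summit.Ventures.HSemireg.Wedge.HankelSiegel Summit.Ventures.HSemireg.Wedge.HankelSiegelIdeal Summit.Ventures.HSemireg.Wedge.KunnethKernel
  Summit.Ventures.HSemireg.Wedge.HankelSecant Summit.Ventures.HSemireg.Wedge.HankelFrameChange Summit.Ventures.HSemireg.Wedge.HankelPureKernel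

variable (K : Type*) [Field K] {n : ℕ}

/-! ## §105. An independent finite family has `dim ⨆ = Σ dim` -/

/-- **an INDEPENDENT finite family of subspaces has `dim (s.sup F) = Σ_{i ∈ s} dim F_i`** (generic). -/
theorem finrank_finset_sup_eq_sum_of_iSupIndep {M : Type*} [AddCommGroup M] [Module K M] [FiniteDimensional K M] {ι : Type*} {F : ι → Submodule K M}
    (hF : iSupIndep F) (s : Finset ι) : finrank K ↥(s.sup F) = ∑ i ∈ s, finrank K (F i) := by
  classical
  induction s using Finset.induction_on with
  | empty => rw [Finset.sup_empty, finrank_bot, Finset.sum_empty]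
  | insert a s ha ih =>
    rw [Finset.sup_insert, Finset.sum_insert ha, ← ih]
    have hdisj : F a ⊓ s.sup F = ⊥ := by
      refine disjoint_iff.mp ((hF a).mono_right ?_)
      rw [Finset.sup_eq_iSup]
      exact iSup₂_le fun j hj => le_iSup₂_of_le (f := fun j (_ : j ≠ a) => F j) j (by rintro rfl; exact ha hj) le_rfl
    have h := Submodule.finrank_sup_add_finrank_inf_eq (F a) (s.sup F)
    rw [hdisj, finrank_bot, add_zero] at h
    exact h

/-- **… in particular `dim ⨆_i F_i = Σ_i dim F_i` over a finite index type.** -/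
theorem finrank_iSup_eq_sum_of_iSupIndep {M : Type*} [AddCommGroup M] [Module K M] [FiniteDimensional K M] {ι : Type*} [Fintype ι] {F : ι → Submodule K M}
    (hF : iSupIndep F) : finrank K ↥(⨆ i, F i) = ∑ i, finrank K (F i) := by
  classical
  rw [← Finset.sup_univ_eq_iSup]; exact finrank_finset_sup_eq_sum_of_iSupIndep K hF _

/-! ## §106. Multiplying images by monomials; left non-degeneracy in small degree -/

section General

variable {I : Type*} [LinearOrder I] [Fintype I]

/-- **`Hom(univ, e) ∧ V(univ, f, a) ≤ V(univ, f, e + a)`**: multiplying the image of `θ ↦ θ ∧ f` on degree `a` by `e`-forms lands in the image on degree `e + a`. -/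
theorem Hom_mul_V_le (e a : ℕ) (f : HT K I) : Hom K I Finset.univ e * V K I Finset.univ f a ≤ V K I Finset.univ f (e + a) := by
  rw [Hom, V, Submodule.span_mul_span, Submodule.span_le]
  rintro _ ⟨_, ⟨U, ⟨-, hU⟩, rfl⟩, _, ⟨s, ⟨-, hs⟩, rfl⟩, rfl⟩
  show B K I U * (B K I s * f) ∈ V K I Finset.univ f (e + a)
  rw [← mul_assoc, B_mul_B]
  by_cases hUs : Disjoint U s
  · rw [smul_mul_assoc]
    exact Submodule.smul_mem _ _ (Submodule.subset_span ⟨U ∪ s, ⟨Finset.subset_univ _, by rw [Finset.card_union_of_disjoint hUs, hU, hs]⟩, rfl⟩)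
  · rw [u_eq_zero K hUs, zero_smul, zero_mul]; exact Submodule.zero_mem _

/-- **LEFT NON-DEGENERACY BY SMALL MONOMIALS**: a homogeneous `x` of degree `d` with `E_U ∧ x = 0` for EVERY `|U| = e`, `e + d ≤ |I|`, is zero (every top-complementary monomial `E_W`,
`|W| = |I| − d ≥ e`, splits as `E_{W∖U} ∧ E_U` up to a unit). -/
theorem eq_zero_of_forall_B_mul_left_eq_zero {d e : ℕ} (hed : e + d ≤ Fintype.card I) {x : HT K I} (hx : x ∈ Hom K I Finset.univ d)
    (h : ∀ U : Finset I, U.card = e → B K I U * x = 0) : x = 0 := by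
  refine eq_zero_of_forall_top_mul_left K (a := Fintype.card I - d) (by omega) hx fun η hη => ?_
  have key : Hom K I Finset.univ (Fintype.card I - d) ≤ LinearMap.ker (LinearMap.mulRight K x) := by
    rw [Hom, Submodule.span_le]
    rintro _ ⟨W, ⟨-, hW⟩, rfl⟩
    rw [SetLike.mem_coe, LinearMap.mem_ker, LinearMap.mulRight_apply]
    show B K I W * x = 0
    obtain ⟨U, hUW, hU⟩ := Finset.exists_subset_card_eq (s := W) (n := e) (by omega)
    have hdisj : Disjoint (W \ U) U := Finset.sdiff_disjoint
    have hWU : W \ U ∪ U = W := Finset.sdiff_union_of_subset hUW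
    have hu : u K (W \ U) U ≠ 0 := (u_ne_zero_iff K).mpr hdisj
    have e1 : B K I W = (u K (W \ U) U)⁻¹ • (B K I (W \ U) * B K I U) := by rw [B_mul_B, hWU, smul_smul, inv_mul_cancel₀ hu, one_smul]
    rw [e1, smul_mul_assoc, mul_assoc, h U hU, mul_zero, smul_zero]
  have := key hη
  rw [LinearMap.mem_ker, LinearMap.mulRight_apply] at this
  rw [this, map_zero]

end General

/-! ## §107. Node images are independent in every degree `k′ ≤ n + 1 − D` -/

/-- **NODE IMAGES IN GENERAL POSITION IN EVERY DEGREE**: distinct `λ_i`, `q_i` of exact order `P_i ≤ k′`, total order `D = Σ_i (P_i + 1) ≤ k + 1` (`k + k′ = n`) ⇒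
**`iSupIndep (i ↦ V(univ, w_n(expMul λ_i q_i), k′))`** — G4's independence in degree `n + 1 − D ≥ k′`, pulled down by left multiplication with monomials of degree `k + 1 − D` (§106). -/
theorem iSupIndep_V_w_expMul_of_total_le {k k' r : ℕ} (hkk' : k + k' = n) {lam : Fin r → K} (hlam : Function.Injective lam) {P : Fin r → ℕ} {q : Fin r → ℕ → K}
    (hq : ∀ i j, P i < j → q i j = 0) (hqP : ∀ i, q i (P i) ≠ 0) (hPk' : ∀ i, P i ≤ k') (hD : ∑ i, (P i + 1) ≤ k + 1) :
    iSupIndep (fun i => V K (In n) Finset.univ (w K n n (expMul K (lam i) (q i))) k') := by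
  rcases Nat.eq_zero_or_pos r with hr | hr
  · subst hr; intro i; exact i.elim0
  set D := ∑ i, (P i + 1) with hDdef
  have hD1 : 1 ≤ D := le_trans (Nat.succ_le_of_lt (Nat.succ_pos _)) (Finset.single_le_sum (fun j _ => Nat.zero_le (P j + 1)) (Finset.mem_univ (⟨0, hr⟩ : Fin r)))
  set e := k + 1 - D with he
  -- G4 in degree e + k′ = n + 1 − D
  have hbig := iSupIndep_V_w_expMul'' K (n := n) (k := D - 1) (k' := e + k') (by omega) hlam hq hqP (fun i => (hPk' i).trans (Nat.le_add_left _ _))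
    (by omega)
  intro i
  rw [disjoint_iff, eq_bot_iff]
  intro x hx
  obtain ⟨hx1, hx2⟩ := Submodule.mem_inf.mp hx
  have hxH : x ∈ Hom K (In n) Finset.univ (k' + n) := V_le_Hom K (by simpa only [Dm_top] using w_mem_Hom K (le_refl n) (expMul K (lam i) (q i))) k' hx1
  rw [Submodule.mem_bot]
  refine eq_zero_of_forall_B_mul_left_eq_zero K (e := e) (by rw [Fintype.card_fin]; omega) hxH fun U hU => ?_
  have hdis := hbig i
  rw [disjoint_iff, eq_bot_iff] at hdis
  have hmul : ∀ j, ∀ y ∈ V K (In n) Finset.univ (w K n n (expMul K (lam j) (q j))) k',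
      B K (In n) U * y ∈ V K (In n) Finset.univ (w K n n (expMul K (lam j) (q j))) (e + k') := fun j y hy =>
    Hom_mul_V_le K e k' _ (Submodule.mul_mem_mul (B_mem_Hom K (Finset.subset_univ U) hU) hy)
  refine (Submodule.mem_bot K).mp (hdis (Submodule.mem_inf.mpr ⟨hmul i x hx1, ?_⟩))
  -- the sum of the other images is mapped into the sum of the other images
  have hle : (⨆ (j) (_ : j ≠ i), V K (In n) Finset.univ (w K n n (expMul K (lam j) (q j))) k') ≤
      ((⨆ (j) (_ : j ≠ i), V K (In n) Finset.univ (w K n n (expMul K (lam j) (q j))) (e + k')).comap (LinearMap.mulLeft K (B K (In n) U))) :=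
    iSup₂_le fun j hj => fun y hy => by
      rw [Submodule.mem_comap, LinearMap.mulLeft_apply]
      exact Submodule.mem_iSup_of_mem j (Submodule.mem_iSup_of_mem hj (hmul j y hy))
  have := hle hx2
  rwa [Submodule.mem_comap, LinearMap.mulLeft_apply] at this

/-- **`dim ⨆_i V(univ, w_n(expMul λ_i q_i), k′) = D·C(n, k)`** for such a divisor (`D ≤ k + 1`; each node image has dimension `(P_i + 1)·C(n, k′)`, F2d). -/
theorem finrank_iSup_V_w_expMul_eq {k k' r : ℕ} (hkk' : k + k' = n) {lam : Fin r → K} (hlam : Function.Injective lam) {P : Fin r → ℕ} {q : Fin r → ℕ → K}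
    (hq : ∀ i j, P i < j → q i j = 0) (hqP : ∀ i, q i (P i) ≠ 0) (hPk' : ∀ i, P i ≤ k') (hD : ∑ i, (P i + 1) ≤ k + 1) :
    finrank K ↥(⨆ i, V K (In n) Finset.univ (w K n n (expMul K (lam i) (q i))) k') = (∑ i, (P i + 1)) * n.choose k := by
  have hPi : ∀ i, P i + 1 ≤ ∑ j, (P j + 1) := fun i => Finset.single_le_sum (fun j _ => Nat.zero_le (P j + 1)) (Finset.mem_univ i)
  rw [finrank_iSup_eq_sum_of_iSupIndep K (iSupIndep_V_w_expMul_of_total_le K hkk' hlam hq hqP hPk' hD), Finset.sum_mul]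
  refine Finset.sum_congr rfl fun i _ => ?_
  rw [finrank_V_w_expMul_of_order K (lam i) (hPk' i) (by have := hPi i; omega) (hq i) (hqP i), ← Nat.choose_symm (show k ≤ n by omega), show n - k = k' by omega]

/-- **NODE KERNELS IN GENERAL POSITION IN EVERY DEGREE: `dim ⋂_i Kr(univ, w_n(expMul λ_i q_i), k) + D·C(n,k) = C(2n,k)`** for distinct `λ_i`, exact orders `P_i` with `k + P_i ≤ n`, total
order `D ≤ k + 1` — F2b's count with NO `D ≤ n + 1 − k` (there the intersection IS the kernel of the divisor class; here it is only the intersection). -/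
theorem finrank_iInf_Kr_w_expMul_add {k r : ℕ} {lam : Fin r → K} (hlam : Function.Injective lam) {P : Fin r → ℕ} {q : Fin r → ℕ → K}
    (hq : ∀ i j, P i < j → q i j = 0) (hqP : ∀ i, q i (P i) ≠ 0) (hkP : ∀ i, k + P i ≤ n) (hD : ∑ i, (P i + 1) ≤ k + 1) (hr : 0 < r) :
    finrank K ↥(⨅ i, Kr K Finset.univ (w K n n (expMul K (lam i) (q i))) k) + (∑ i, (P i + 1)) * n.choose k = (n + n).choose k := by
  have hk : k ≤ n := by have := hkP ⟨0, hr⟩; omega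
  have hkk' : k + (n - k) = n := by omega
  rw [← Ann_iSup_V_w_eq_iInf_Kr K hkk' hr, ← finrank_iSup_V_w_expMul_eq K hkk' hlam hq hqP (fun i => by have := hkP i; omega) hD]
  have h := finrank_Ann_add K (a := k) (b := n - k + n) (I := In n) (by rw [Fintype.card_fin]; omega)
    (W := ⨆ i, V K (In n) Finset.univ (w K n n (expMul K (lam i) (q i))) (n - k)) (iSup_le fun i => (V_w_le_coSiegel K hkk' _).trans (coSiegel_le_Hom K _))
  rwa [Fintype.card_fin] at h

/-! ## §108. Divisor Torelli in every degree -/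

/-- the intersection over a `Fin.cons`-extended divisor splits off the new node. -/
lemma iInf_Kr_cons {r k : ℕ} (lam : Fin r → K) (q : Fin r → ℕ → K) (mu : K) (s : ℕ → K) :
    (⨅ i : Fin (r + 1), Kr K Finset.univ (w K n n (expMul K ((Fin.cons mu lam : Fin (r + 1) → K) i) ((Fin.cons s q : Fin (r + 1) → ℕ → K) i))) k) =
      Kr K Finset.univ (w K n n (expMul K mu s)) k ⊓ ⨅ i, Kr K Finset.univ (w K n n (expMul K (lam i) (q i))) k := by
  refine le_antisymm (le_inf ?_ (le_iInf fun i => ?_)) (le_iInf fun i => ?_)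
  · exact (iInf_le _ 0).trans (by simp only [Fin.cons_zero]; exact le_rfl)
  · exact (iInf_le _ i.succ).trans (by simp only [Fin.cons_succ]; exact le_rfl)
  · refine Fin.cases ?_ (fun j => ?_) i
    · simp only [Fin.cons_zero]; exact inf_le_left
    · simp only [Fin.cons_succ]; exact inf_le_right.trans (iInf_le _ j)

/-- **A DIVISOR OF TOTAL ORDER `≤ k` DOES NOT SEE A FURTHER SLOPE: `⋂_i Kr(univ, w_n(expMul λ_i q_i), k) ⊄ Kr(univ, w_n(B μ^•), k)`** for `μ ∉ {λ_i}`, `B ≠ 0`, exact orders `P_i` with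
`k + P_i ≤ n`, `Σ_i (P_i + 1) ≤ k` (adding the simple node `μ` keeps the node kernels in general position, §107, so it costs `C(n,k) > 0` dimensions). -/
theorem iInf_Kr_w_expMul_not_le_Kr_w_exp {k r : ℕ} {lam : Fin r → K} (hlam : Function.Injective lam) {P : Fin r → ℕ} {q : Fin r → ℕ → K}
    (hq : ∀ i j, P i < j → q i j = 0) (hqP : ∀ i, q i (P i) ≠ 0) (hkP : ∀ i, k + P i ≤ n) (hk : k ≤ n) (hD : ∑ i, (P i + 1) ≤ k) {mu : K}
    (hmu : mu ∉ Set.range lam) {B : K} (hB : B ≠ 0) (hr : 0 < r) :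
    ¬ (⨅ i, Kr K Finset.univ (w K n n (expMul K (lam i) (q i))) k) ≤ Kr K Finset.univ (w K n n (fun j => B * mu ^ j)) k := by
  intro hle
  -- the extended divisor μ (simple) + A
  have hcons : Function.Injective (Fin.cons mu lam : Fin (r + 1) → K) := Fin.cons_injective_of_injective hmu hlam
  set P' : Fin (r + 1) → ℕ := Fin.cons 0 P with hP'
  set q' : Fin (r + 1) → ℕ → K := Fin.cons (fun j => if j = 0 then B else 0) q with hq'
  have hq'0 : ∀ i j, P' i < j → q' i j = 0 := fun i =>
    Fin.cases (fun j hj => by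
        rw [hP', Fin.cons_zero] at hj; rw [hq', Fin.cons_zero]; exact if_neg (by omega))
      (fun i' j hj => by rw [hP', Fin.cons_succ] at hj; rw [hq', Fin.cons_succ]; exact hq i' j hj) i
  have hq'P : ∀ i, q' i (P' i) ≠ 0 := fun i =>
    Fin.cases (by
        rw [hq', Fin.cons_zero, hP', Fin.cons_zero]
        show (if (0 : ℕ) = 0 then B else 0) ≠ 0
        rw [if_pos rfl]; exact hB)
      (fun i' => by rw [hq', hP', Fin.cons_succ, Fin.cons_succ]; exact hqP i') i
  have hkP' : ∀ i, k + P' i ≤ n := fun i =>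
    Fin.cases (by rw [hP', Fin.cons_zero]; omega) (fun i' => by rw [hP', Fin.cons_succ]; exact hkP i') i
  have hD' : ∑ i, (P' i + 1) = (∑ i, (P i + 1)) + 1 := by
    rw [Fin.sum_univ_succ, hP']; simp only [Fin.cons_zero, Fin.cons_succ]; omega
  have h1 := finrank_iInf_Kr_w_expMul_add K hcons hq'0 hq'P hkP' (by omega) (Nat.succ_pos r)
  have h2 := finrank_iInf_Kr_w_expMul_add K hlam hq hqP hkP (by omega) hr
  have e : (⨅ i, Kr K Finset.univ (w K n n (expMul K ((Fin.cons mu lam : Fin (r + 1) → K) i) (q' i))) k) =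
      ⨅ i, Kr K Finset.univ (w K n n (expMul K (lam i) (q i))) k := by
    rw [hq', iInf_Kr_cons, inf_eq_right]
    have eB : expMul K mu (fun j => if j = 0 then B else 0) = fun j => B * mu ^ j := funext fun j => expMul_spike_zero K mu B j
    rw [eB]; exact hle
  rw [e, hD'] at h1
  have hpos : 0 < n.choose k := Nat.choose_pos hk
  have : (∑ i, (P i + 1) + 1) * n.choose k = (∑ i, (P i + 1)) * n.choose k + n.choose k := by ring
  omega

/-- **NOR DOES IT SEE A HIGHER ORDER AT ONE OF ITS OWN NODES: `⋂_i Kr(univ, w_n(expMul λ_i q_i), k) ⊄ Kr(univ, w_n(expMul λ_{i₀} δ_{P_{i₀}+1}), k)`** (total order `≤ k`,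
`k + P_{i₀} + 1 ≤ n`): raising the order at `λ_{i₀}` by one costs `C(n,k) > 0` dimensions (§107). -/
theorem iInf_Kr_w_expMul_not_le_succ {k r : ℕ} {lam : Fin r → K} (hlam : Function.Injective lam) {P : Fin r → ℕ} {q : Fin r → ℕ → K}
    (hq : ∀ i j, P i < j → q i j = 0) (hqP : ∀ i, q i (P i) ≠ 0) (hkP : ∀ i, k + P i ≤ n) (hD : ∑ i, (P i + 1) ≤ k) (i₀ : Fin r) (hkP₀ : k + P i₀ + 1 ≤ n) :
    ¬ (⨅ i, Kr K Finset.univ (w K n n (expMul K (lam i) (q i))) k) ≤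
        Kr K Finset.univ (w K n n (expMul K (lam i₀) (fun j => if j = P i₀ + 1 then (1 : K) else 0))) k := by
  classical
  intro hle
  have hr : 0 < r := Fin.pos i₀
  -- the raised divisor: order P i₀ + 2 at λ_{i₀}, realised by the spike δ_{P i₀ + 1}
  set P' : Fin r → ℕ := Function.update P i₀ (P i₀ + 1) with hP'
  set q' : Fin r → ℕ → K := Function.update q i₀ (fun j => if j = P i₀ + 1 then (1 : K) else 0) with hq'
  have hP'i : ∀ i, P' i = if i = i₀ then P i₀ + 1 else P i := fun i => by rw [hP', Function.update_apply]
  have hq'i : ∀ i, q' i = if i = i₀ then (fun j => if j = P i₀ + 1 then (1 : K) else 0) else q i := fun i => by rw [hq', Function.update_apply]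
  have hq'0 : ∀ i j, P' i < j → q' i j = 0 := by
    intro i j hj; rw [hP'i] at hj; rw [hq'i]
    by_cases hi : i = i₀
    · rw [if_pos hi] at hj ⊢; exact if_neg (by omega)
    · rw [if_neg hi] at hj ⊢; exact hq i j hj
  have hq'P : ∀ i, q' i (P' i) ≠ 0 := by
    intro i; rw [hP'i, hq'i]
    by_cases hi : i = i₀
    · rw [if_pos hi, if_pos hi, if_pos rfl]; exact one_ne_zero
    · rw [if_neg hi, if_neg hi]; exact hqP i
  have hkP' : ∀ i, k + P' i ≤ n := by
    intro i; rw [hP'i]; by_cases hi : i = i₀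
    · rw [if_pos hi]; omega
    · rw [if_neg hi]; exact hkP i
  have hD' : ∑ i, (P' i + 1) = (∑ i, (P i + 1)) + 1 := by
    rw [← Finset.add_sum_erase _ _ (Finset.mem_univ i₀), ← Finset.add_sum_erase _ (fun i => P i + 1) (Finset.mem_univ i₀), hP'i, if_pos rfl]
    have : ∑ x ∈ Finset.univ.erase i₀, (P' x + 1) = ∑ x ∈ Finset.univ.erase i₀, (P x + 1) :=
      Finset.sum_congr rfl fun i hi => by rw [hP'i, if_neg (Finset.ne_of_mem_erase hi)]
    rw [this]; ring
  have h1 := finrank_iInf_Kr_w_expMul_add K hlam hq'0 hq'P hkP' (by omega) hr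
  have h2 := finrank_iInf_Kr_w_expMul_add K hlam hq hqP hkP (by omega) hr
  -- the raised intersection equals the old one under `hle` (the raised node kernel lies in the old node kernel)
  have e : (⨅ i, Kr K Finset.univ (w K n n (expMul K (lam i) (q' i))) k) = ⨅ i, Kr K Finset.univ (w K n n (expMul K (lam i) (q i))) k := by
    refine le_antisymm (le_iInf fun i => (iInf_le _ i).trans ?_) (le_iInf fun i => ?_)
    · rw [hq'i]
      by_cases hi : i = i₀
      · rw [if_pos hi]; subst hi
        rw [Kr_w_expMul_of_order K (lam i) (P := P i + 1) hkP₀ (fun j hj => if_neg (by omega)) (by rw [if_pos rfl]; exact one_ne_zero),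
          Kr_w_expMul_of_order K (lam i) (hkP i) (hq i) (hqP i)]
        exact sup_le_sup_left (Submodule.map_mono (xRich_anti K (Nat.le_succ _))) _
      · rw [if_neg hi]
    · rw [hq'i]
      by_cases hi : i = i₀
      · rw [if_pos hi]; subst hi; exact hle
      · rw [if_neg hi]; exact iInf_le _ i
  rw [e, hD'] at h1
  have hpos : 0 < n.choose k := Nat.choose_pos (by omega)
  have : (∑ i, (P i + 1) + 1) * n.choose k = (∑ i, (P i + 1)) * n.choose k + n.choose k := by ring
  omega

/-- the order-`(P+1)` node kernel lies in the kernel of every class of lower exact order at the same node (E5's names; `k + P ≤ n`). -/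
lemma Kr_w_expMul_le_of_order_le (lam : K) {k P t : ℕ} (htP : t ≤ P) (hkP : k + P ≤ n) {q s : ℕ → K} (hq : ∀ j, P < j → q j = 0) (hqP : q P ≠ 0)
    (hs : ∀ j, t < j → s j = 0) (hst : s t ≠ 0) :
    Kr K Finset.univ (w K n n (expMul K lam q)) k ≤ Kr K Finset.univ (w K n n (expMul K lam s)) k := by
  rw [Kr_w_expMul_of_order K lam hkP hq hqP, Kr_w_expMul_of_order K lam (by omega) hs hst]
  exact sup_le_sup_left (Submodule.map_mono (xRich_anti K htP)) _

/-- **DIVISOR TORELLI IN EVERY DEGREE — THE NODES**: two divisors (distinct nodes each, exact orders, `k + P ≤ n`, total orders `≤ k`, `k ≤ n`) whose node kernels have the same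
intersection in degree `k` have the same node SET. -/
theorem range_eq_of_iInf_Kr_w_expMul_eq {k r s : ℕ} (hk : k ≤ n) {lam : Fin r → K} (hlam : Function.Injective lam) {P : Fin r → ℕ} {q : Fin r → ℕ → K}
    (hq : ∀ i j, P i < j → q i j = 0) (hqP : ∀ i, q i (P i) ≠ 0) (hkP : ∀ i, k + P i ≤ n) (hD : ∑ i, (P i + 1) ≤ k) (hr : 0 < r)
    {nu : Fin s → K} (hnu : Function.Injective nu) {P' : Fin s → ℕ} {q' : Fin s → ℕ → K}
    (hq' : ∀ i j, P' i < j → q' i j = 0) (hqP' : ∀ i, q' i (P' i) ≠ 0) (hkP' : ∀ i, k + P' i ≤ n) (hD' : ∑ i, (P' i + 1) ≤ k) (hs : 0 < s)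
    (heq : (⨅ i, Kr K Finset.univ (w K n n (expMul K (lam i) (q i))) k) = ⨅ i, Kr K Finset.univ (w K n n (expMul K (nu i) (q' i))) k) :
    Set.range lam = Set.range nu := by
  refine Set.Subset.antisymm ?_ ?_
  · rintro _ ⟨i, rfl⟩
    by_contra hmem
    refine iInf_Kr_w_expMul_not_le_Kr_w_exp K hnu hq' hqP' hkP' hk hD' hmem one_ne_zero hs ?_
    rw [← heq]
    exact (iInf_le _ i).trans (Kr_w_expMul_le_of_order_le K (lam i) (Nat.zero_le _) (hkP i) (hq i) (hqP i) (s := fun j => if j = 0 then (1 : K) else 0)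
      (fun j hj => if_neg (by omega)) (by rw [if_pos rfl]; exact one_ne_zero) |>.trans (by rw [show (fun j => (1 : K) * lam i ^ j) = expMul K (lam i) (fun t => if t = 0 then (1 : K) else 0) from funext fun j => (expMul_spike_zero K (lam i) 1 j).symm]))
  · rintro _ ⟨j, rfl⟩
    by_contra hmem
    refine iInf_Kr_w_expMul_not_le_Kr_w_exp K hlam hq hqP hkP hk hD hmem one_ne_zero hr ?_
    rw [heq]
    exact (iInf_le _ j).trans (Kr_w_expMul_le_of_order_le K (nu j) (Nat.zero_le _) (hkP' j) (hq' j) (hqP' j) (s := fun t => if t = 0 then (1 : K) else 0)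
      (fun t ht => if_neg (by omega)) (by rw [if_pos rfl]; exact one_ne_zero) |>.trans (by rw [show (fun t => (1 : K) * nu j ^ t) = expMul K (nu j) (fun t => if t = 0 then (1 : K) else 0) from funext fun t => (expMul_spike_zero K (nu j) 1 t).symm]))

/-- **DIVISOR TORELLI IN EVERY DEGREE — THE ORDERS**: under the same hypotheses, a node common to both divisors carries the same order in both. -/
theorem order_eq_of_iInf_Kr_w_expMul_eq {k r s : ℕ} {lam : Fin r → K} (hlam : Function.Injective lam) {P : Fin r → ℕ} {q : Fin r → ℕ → K}
    (hq : ∀ i j, P i < j → q i j = 0) (hqP : ∀ i, q i (P i) ≠ 0) (hkP : ∀ i, k + P i ≤ n) (hD : ∑ i, (P i + 1) ≤ k)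
    {nu : Fin s → K} (hnu : Function.Injective nu) {P' : Fin s → ℕ} {q' : Fin s → ℕ → K}
    (hq' : ∀ i j, P' i < j → q' i j = 0) (hqP' : ∀ i, q' i (P' i) ≠ 0) (hkP' : ∀ i, k + P' i ≤ n) (hD' : ∑ i, (P' i + 1) ≤ k)
    (heq : (⨅ i, Kr K Finset.univ (w K n n (expMul K (lam i) (q i))) k) = ⨅ i, Kr K Finset.univ (w K n n (expMul K (nu i) (q' i))) k)
    {i : Fin r} {j : Fin s} (hij : lam i = nu j) : P i = P' j := by
  by_contra hne
  rcases Nat.lt_or_gt_of_ne hne with hlt | hlt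
  · -- P i < P' j: the j-th node kernel of the second divisor lies in the order-(P i + 2) kernel at λ_i
    refine iInf_Kr_w_expMul_not_le_succ K hlam hq hqP hkP hD i (by have := hkP' j; omega) ?_
    rw [heq, hij]
    exact (iInf_le _ j).trans (Kr_w_expMul_le_of_order_le K (nu j) (P := P' j) (t := P i + 1) (by omega) (hkP' j) (hq' j) (hqP' j)
      (fun t ht => if_neg (by omega)) (by rw [if_pos rfl]; exact one_ne_zero))
  · refine iInf_Kr_w_expMul_not_le_succ K hnu hq' hqP' hkP' hD' j (by have := hkP i; omega) ?_
    rw [← heq, ← hij]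
    exact (iInf_le _ i).trans (Kr_w_expMul_le_of_order_le K (lam i) (P := P i) (t := P' j + 1) (by omega) (hkP i) (hq i) (hqP i)
      (fun t ht => if_neg (by omega)) (by rw [if_pos rfl]; exact one_ne_zero))

end Summit.Ventures.HSemireg.Wedge.KernelDuality
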